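import Literature.AnabelianGeometry.AbsoluteAnabelian.ArchimedeanUnivCover
import Literature.AnabelianGeometry.AbsoluteAnabelian.ArchimedeanLogFrobeniusFunctors
import HarnessLib

/-!
# [AbsTopIII] Lemma 4.4 for an arbitrary CAF — the `k^×`-codomain form

Mochizuki, *Topics in Absolute Anabelian Geometry III*, Lemma 4.4 p. 107 of the author's kurims
manuscript (lit key `paper:url-5493eb38cbb7`; bib key `MochizukiAbsTopIII2015`): "no composite of the
form `k^× →α (k~)^× ↪ k~ ↠ k^×` … is bijective".  PROOF-ONLY supplement (abc-iut cell, seat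
abc-iut-w5-d210; L4-lead RULINGS #2 (5), reviewer note on p415198) to `ArchimedeanUnivCover.lean`
(p414375): there the general-CAF composite was typed with codomain `k` (`z ↦ exp_k (α z) : kˣ → k`),
whose NON-INJECTIVITY (`IsCAF.lemma44_not_injective_of_isCAF`) is the printed content but whose
non-bijectivity is cheap (`0` is never a value).  Here the composite is typed EXACTLY as printed, with
codomain `k^×` (`Units.mk0`, as in abc-iut-L4-t14's landed `AddMulDistinguishableArch` for `k = ℂ`):

* `IsCAF.lemma44Units_not_injective` / `IsCAF.lemma44Units_of_isCAF` — for every CAF `k` and every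
  isomorphism of topological groups `α : k^× ⥲ (k~)^× = k^×`, the composite
  `k^× →α k^× ↪ k ↠ k^×`, `z ↦ exp_k (α z) ∈ k^×`, is not injective, hence not bijective;
* `addMulDistinguishableArch_of_isCAF` — abc-iut-L4-t14's `AddMulDistinguishableArch` (the case
  `k = ℂ`, `exp_k = Complex.exp`) recovered as the specialisation of the general statement.

Classical; nothing here bears on [IUTchIII] Cor. 3.12 or takes a side.
-/

namespace Literature.AnabelianGeometry.AbsoluteAnabelian

universe u

noncomputable section

namespace IsCAF

variable {k : Type u} [NormedField k]

/-- **Lemma 4.4 for an arbitrary CAF, printed (`k^×`-codomain) form, injectivity**: the composite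
`k^× →α (k~)^× ↪ k~ ↠ k^×` is not injective ("the non-injectivity of `k~ ↠ k^×` implies that the
composite under consideration fails to be injective"). [cite: MochizukiAbsTopIII2015, Lemma 4.4 p.107] -/
theorem lemma44Units_not_injective [CharZero k] (hk : IsCAF k) (α : kˣ ≃ₜ* kˣ) :
    ¬ Function.Injective
      (fun z : kˣ => Units.mk0 (univCover k ((α z : kˣ) : k)) (univCover_ne_zero hk _)) := by
  intro hinj
  refine lemma44_not_injective_of_isCAF hk α fun z₁ z₂ h => hinj ?_
  exact Units.ext (by simpa using h)

/-- **Lemma 4.4 for an arbitrary CAF, printed (`k^×`-codomain) form**: no composite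
`k^× →α (k~)^× ↪ k~ ↠ k^×` (`α` an isomorphism of topological groups) is bijective.
[cite: MochizukiAbsTopIII2015, Lemma 4.4 p.107] -/
theorem lemma44Units_of_isCAF [CharZero k] (hk : IsCAF k) (α : kˣ ≃ₜ* kˣ) :
    ¬ Function.Bijective
      (fun z : kˣ => Units.mk0 (univCover k ((α z : kˣ) : k)) (univCover_ne_zero hk _)) :=
  fun h => lemma44Units_not_injective hk α h.1

end IsCAF

/-- abc-iut-L4-t14's **`AddMulDistinguishableArch`** (Lemma 4.4 for `k = ℂ`, `k~ ↠ k^×` the complex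
exponential into `ℂ^×`) is the specialisation of `IsCAF.lemma44Units_of_isCAF` at `k = ℂ`
(`univCover ℂ = Complex.exp`). [cite: MochizukiAbsTopIII2015, Lemma 4.4 p.107] -/
theorem addMulDistinguishableArch_of_isCAF : AddMulDistinguishableArch := by
  intro α hbij
  refine IsCAF.lemma44Units_of_isCAF isCAF_complex α ⟨fun z₁ z₂ h => hbij.1 ?_, fun u => ?_⟩
  · exact Units.ext (by simpa [univCover_complex] using congrArg (fun v : ℂˣ => (v : ℂ)) h)
  · obtain ⟨z, hz⟩ := hbij.2 u
    exact ⟨z, Units.ext (by simpa [univCover_complex] using congrArg (fun v : ℂˣ => (v : ℂ)) hz)⟩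

end

end Literature.AnabelianGeometry.AbsoluteAnabelian
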